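import Summits.CriticalPhenomena.PercolationContinuityZ3.Theorems.PercNearOneGluingNoHeavyLowerTailSahiCombTriWAndClaw

/-!
# AND with a claw-plus block `clawPlus p q = claw k ∪ {⊤ ∖ {p,q}}` (`k ≥ 4`): the family `maj3(x_p x_q, ·)`-type blocks, e.g. `e888`

Support file of the one-cut programme (crux `NoHeavyLowerTail`, stmt-CriticalPhenomena-4575; unit `prim-lf-1` gen 49).
Continuation of `…SahiCombTriWAndClaw` (AND with a claw block; main lemma `sum_clawS_sq_le_corP_andProd_claw`).

For distinct `p q : Fin k` put `clawPlus p q = claw k ∪ {univ ∖ {p,q}}` — "all of `k` but at most one, or all but exactly `{p,q}`"; as a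
Boolean function `claw_{k-1}(x_p x_q, x_r, …)` = the claw with ONE PRONG DOUBLED (an AND-substitution).  For `k = 4` this is the block
`e888 = x₀x₁ ∨ (x₀∨x₁)x₂x₃ ≅ {01, 012, 013, 023, 123, 0123}` of the unit's hard list (so far only a 41-term machine certificate, memo gen 47 §6),
for `k = 5` the block `e8808080`.
* `clawPlus`, `mem_clawPlus`, `sum_clawPlus`, `isUpperSet_clawPlus`, `disjoint_clawPlus_refl` (`k ≥ 4`).
* The extra column `clawV A p q x = [x ⊔ (⊤∖{p,q}) ∈ A] − [xᶜ ⊔ {p,q} ∈ A]`: bounded by the two co-atom columns `w_p, w_q`, hence by the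
  second-largest sorted column `s_{k-2}` (`clawV_le_clawS`); pair conditions against every other co-atom column and hence against `s_j`, `j ≥ 2`
  (`clawV_add_clawS_nonneg`); so `v + s_{k-2}` is a two-layer `K`-vector.
* `clawV_add_clawV_nonneg` (two extra columns from disjoint pairs cover `⊤`), `rearr_two` — used by the next file.
* **`corP_andProd_clawPlus_nonneg`** (`k ≥ 4`, `p ≠ q`): `Cor_{P₁ ∧ clawPlus p q}(A,B) ≥ 0` for every antipode-free up-set `P₁` with `Cor_{P₁} ≥ 0`
  and all up-sets `A, B`; `klShell_andProd_clawPlus`, **`triW_nonneg_andProd_clawPlus`**, `lForm_le_scoreVal_andProd_clawPlus` (the typed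
  conjecture `AndShellLower` for these blocks), example `corP_maj3_andProd_clawPlus_nonneg`.
Proof (two lines on top of the claw main lemma): `Cor_{P₁ ∧ clawPlus} = Σ_x v v' + Cor_{P₁ ∧ claw k} ≥ Σ_x (v v' + c c')` with `c = s_{k-2}`, and
`vv' + cc' = ½(v+c)(v'+c') + ½(c−v)(c'−v)` with `v + c` a two-layer `K`-vector and `c − v ≥ 0`.
HONEST LABEL: complete proofs, std axioms; a new infinite stratum of `TriWIneq` (all `P₁ ∧ clawPlus`, `k ≥ 4`, and iterates); the general
AND conjecture `AndShellLower` and the other AND-substituted claws (`claw ∘ (AND blocks)` with larger or several blocks) stay OPEN. [this work]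
-/

namespace Summit.CriticalPhenomena.PercolationContinuityZ3.Theorems

namespace FiveUpSet

open Finset

variable {γ₁ : Type} [DecidableEq γ₁] [Fintype γ₁] {k : ℕ}

/-! ### The claw-plus family -/

/-- `clawPlus p q = claw k ∪ {univ ∖ {p,q}}`. [this work] -/
def clawPlus (p q : Fin k) : Finset (Finset (Fin k)) := insert ((univ.erase p).erase q) (claw k)

/-- Membership in `clawPlus p q`. [this work] -/
theorem mem_clawPlus {p q : Fin k} {y : Finset (Fin k)} : y ∈ clawPlus p q ↔ y = (univ.erase p).erase q ∨ k ≤ y.card + 1 := by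
  unfold clawPlus; rw [mem_insert, mem_claw]

/-- The cardinality of the extra element. [this work] -/
theorem card_erase_erase {p q : Fin k} (hpq : p ≠ q) : ((univ.erase p).erase q).card = k - 2 := by
  rw [card_erase_of_mem (mem_erase.2 ⟨fun h => hpq h.symm, mem_univ q⟩), card_erase_of_mem (mem_univ p), card_univ, Fintype.card_fin]
  omega

/-- The extra element is not in the claw. [this work] -/
theorem erase_erase_notMem_claw {p q : Fin k} (hpq : p ≠ q) : (univ.erase p).erase q ∉ claw k := by
  rw [mem_claw, card_erase_erase hpq]
  have : 2 ≤ k := by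
    have h1 := Fintype.card_le_of_injective (fun b : Bool => if b then p else q) (by
      intro b b' h; cases b <;> cases b' <;> simp at h <;> first | rfl | exact absurd h hpq | exact absurd h.symm hpq)
    simpa using h1
  omega

/-- Summing over `clawPlus p q`: the extra element and the claw. [this work] -/
theorem sum_clawPlus {p q : Fin k} (hpq : p ≠ q) (f : Finset (Fin k) → ℤ) :
    ∑ y ∈ clawPlus p q, f y = f ((univ.erase p).erase q) + ∑ y ∈ claw k, f y := by
  unfold clawPlus; rw [sum_insert (erase_erase_notMem_claw hpq)]

/-- `clawPlus p q` is an up-set. [this work] -/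
theorem isUpperSet_clawPlus {p q : Fin k} (hpq : p ≠ q) : IsUpperSet (clawPlus p q : Set (Finset (Fin k))) := by
  intro y y' hyy' hy
  rw [mem_coe, mem_clawPlus] at hy ⊢
  rcases hy with rfl | hy
  · by_cases h : y' = (univ.erase p).erase q
    · exact Or.inl h
    · right
      have hlt : ((univ.erase p).erase q).card < y'.card :=
        card_lt_card (lt_of_le_of_ne hyy' (fun h' => h h'.symm))
      rw [card_erase_erase hpq] at hlt
      omega
  · exact Or.inr (hy.trans (by have := card_le_card hyy'; omega))

/-- `clawPlus p q` is antipode free for `k ≥ 4`. [this work] -/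
theorem disjoint_clawPlus_refl (hk : 4 ≤ k) {p q : Fin k} (hpq : p ≠ q) : Disjoint (clawPlus p q) (refl (clawPlus p q)) := by
  rw [disjoint_left]
  intro y hy hy'
  rw [mem_refl, mem_clawPlus] at hy'
  rw [mem_clawPlus] at hy
  have hc := card_compl y
  rw [Fintype.card_fin] at hc
  have hcy := card_le_univ y
  rw [Fintype.card_fin] at hcy
  have hce := card_erase_erase hpq
  have hp : p ∉ (univ.erase p).erase q := fun h => (mem_erase.1 (mem_erase.1 h).2).1 rfl
  rcases hy with rfl | hy <;> rcases hy' with h' | h'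
  · -- `eᶜ = e` is impossible: `p ∈ eᶜ`
    exact hp (h' ▸ mem_compl.2 hp)
  · rw [hce] at hc; omega
  · have hpc : p ∈ y := by
      by_contra hny
      exact hp (h' ▸ mem_compl.2 hny)
    have : yᶜ.card = k - 2 := by rw [h', hce]
    omega
  · omega

/-! ### The extra column -/

/-- The extra column: `v_A(x) = [x ⊔ (⊤∖{p,q}) ∈ A] − [xᶜ ⊔ {p,q} ∈ A]`. [this work] -/
def clawV (A : Finset (Finset (γ₁ ⊕ Fin k))) (p q : Fin k) (x : Finset γ₁) : ℤ := sgnDiff A (refl A) (x.disjSum ((univ.erase p).erase q))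

/-- The extra column as a difference of indicators. [this work] -/
theorem clawV_eq (A : Finset (Finset (γ₁ ⊕ Fin k))) (p q : Fin k) (x : Finset γ₁) :
    clawV A p q x = ind A (x.disjSum ((univ.erase p).erase q)) - ind A (xᶜ.disjSum ((univ.erase p).erase q)ᶜ) := by
  unfold clawV; rw [sgnDiff_refl_eq, compl_disjSum]

/-- Values of the extra column lie in `[-1,1]`. [this work] -/
theorem clawV_bounds (A : Finset (Finset (γ₁ ⊕ Fin k))) (p q : Fin k) (x : Finset γ₁) : -1 ≤ clawV A p q x ∧ clawV A p q x ≤ 1 := by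
  rw [clawV_eq]
  have h1 := ind_nonneg_le_one A (x.disjSum ((univ.erase p).erase q))
  have h2 := ind_nonneg_le_one A (xᶜ.disjSum ((univ.erase p).erase q)ᶜ)
  constructor <;> linarith

section vfacts
variable {A : Finset (Finset (γ₁ ⊕ Fin k))} (hA : IsUpperSet (A : Set (Finset (γ₁ ⊕ Fin k)))) {p q : Fin k}
include hA

/-- The extra column is increasing. [this work] -/
theorem clawV_mono {x x' : Finset γ₁} (h : x ⊆ x') : clawV A p q x ≤ clawV A p q x' := by
  rw [clawV_eq, clawV_eq]
  have h1 := ind_mono_pt hA (disjSum_mono h (le_refl ((univ.erase p).erase q)))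
  have h2 := ind_mono_pt hA (disjSum_mono (compl_subset_compl.2 h) (le_refl ((univ.erase p).erase q)ᶜ))
  linarith

/-- The extra column is dominated by the co-atom column `p`. [this work] -/
theorem clawV_le_clawW_left (x : Finset γ₁) : clawV A p q x ≤ clawW A p x := by
  rw [clawV_eq, clawW_eq]
  have h1 := ind_mono_pt hA (disjSum_mono (le_refl x) (erase_subset q (univ.erase p)))
  have hsub : ({p} : Finset (Fin k)) ⊆ ((univ.erase p).erase q)ᶜ := by
    intro a ha; rw [mem_singleton] at ha; rw [ha, mem_compl]; exact fun h => (mem_erase.1 (mem_erase.1 h).2).1 rfl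
  have h2 := ind_mono_pt hA (disjSum_mono (le_refl xᶜ) hsub)
  linarith

/-- The extra column is dominated by the co-atom column `q`. [this work] -/
theorem clawV_le_clawW_right (x : Finset γ₁) : clawV A p q x ≤ clawW A q x := by
  rw [clawV_eq, clawW_eq]
  have he : (univ.erase p).erase q ⊆ univ.erase q := by
    intro a ha; exact mem_erase.2 ⟨(mem_erase.1 ha).1, mem_univ a⟩
  have h1 := ind_mono_pt hA (disjSum_mono (le_refl x) he)
  have hsub : ({q} : Finset (Fin k)) ⊆ ((univ.erase p).erase q)ᶜ := by
    intro a ha; rw [mem_singleton] at ha; rw [ha, mem_compl]; exact fun h => (mem_erase.1 h).1 rfl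
  have h2 := ind_mono_pt hA (disjSum_mono (le_refl xᶜ) hsub)
  linarith

/-- Pair condition of the extra column against every OTHER co-atom column: `r ∉ {p,q}, x ∪ x' = ⊤ ⟹ v(x) + w_r(x') ≥ 0`. [this work] -/
theorem clawV_add_clawW_nonneg {r : Fin k} (hrp : r ≠ p) (hrq : r ≠ q) {x x' : Finset γ₁} (h : x ∪ x' = univ) :
    0 ≤ clawV A p q x + clawW A r x' := by
  rw [clawV_eq, clawW_eq]
  have hc : xᶜ ⊆ x' := by
    intro a ha; rw [mem_compl] at ha
    have := mem_univ a; rw [← h, mem_union] at this; tauto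
  have hc' : x'ᶜ ⊆ x := by
    intro a ha; rw [mem_compl] at ha
    have := mem_univ a; rw [← h, mem_union] at this; tauto
  have h1s : ((univ.erase p).erase q)ᶜ ⊆ univ.erase r := by
    intro a ha
    rw [mem_compl] at ha
    refine mem_erase.2 ⟨fun har => ha ?_, mem_univ a⟩
    rw [har]; exact mem_erase.2 ⟨hrq, mem_erase.2 ⟨hrp, mem_univ r⟩⟩
  have h2s : ({r} : Finset (Fin k)) ⊆ (univ.erase p).erase q := by
    intro a ha; rw [mem_singleton] at ha; rw [ha]; exact mem_erase.2 ⟨hrq, mem_erase.2 ⟨hrp, mem_univ r⟩⟩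
  have h1 := ind_mono_pt hA (disjSum_mono hc h1s)
  have h2 := ind_mono_pt hA (disjSum_mono hc' h2s)
  linarith

/-- **The extra column is dominated by the second-largest sorted co-atom column** (it lies below two of the columns). [this work] -/
theorem clawV_le_clawS (hpq : p ≠ q) (x : Finset γ₁) (jc : Fin k) (hjc : (jc : ℕ) = k - 2) : clawV A p q x ≤ clawS A x jc := by
  by_contra hlt
  have hle : clawS A x jc ≤ clawV A p q x - 1 := by omega
  rw [clawS_le_iff] at hle
  -- the columns `≤ v - 1` avoid `p` and `q`
  have hsub : (univ.filter fun i => clawW A i x ≤ clawV A p q x - 1) ⊆ (univ.erase p).erase q := by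
    intro i hi
    rw [mem_filter] at hi
    refine mem_erase.2 ⟨fun hiq => ?_, mem_erase.2 ⟨fun hip => ?_, mem_univ i⟩⟩
    · have := clawV_le_clawW_right hA (p := p) (q := q) x; rw [hiq] at hi; omega
    · have := clawV_le_clawW_left hA (p := p) (q := q) x; rw [hip] at hi; omega
  have := card_le_card hsub
  rw [card_erase_erase hpq] at this
  omega

/-- **Pair condition of the extra column against the sorted columns of index `≥ 2`**: among the three smallest columns at `x'` one is
neither `p` nor `q`. [this work] -/
theorem clawV_add_clawS_nonneg {x x' : Finset γ₁} (h : x ∪ x' = univ) (j : Fin k) (hj : 2 ≤ (j : ℕ)) :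
    0 ≤ clawV A p q x + clawS A x' j := by
  have hk : 2 < k := lt_of_le_of_lt hj j.isLt
  let i0 : Fin k := ⟨0, by omega⟩
  let i1 : Fin k := ⟨1, by omega⟩
  let i2 : Fin k := ⟨2, by omega⟩
  -- one of `σ i0, σ i1, σ i2` is neither `p` nor `q` (`σ` = the sorting permutation at `x'`)
  have hex : ∃ i : Fin k, i ≤ j ∧ clawSort A x' i ≠ p ∧ clawSort A x' i ≠ q := by
    have d01 : clawSort A x' i0 ≠ clawSort A x' i1 := fun e => by
      have := congrArg Fin.val ((clawSort A x').injective e); simp [i0, i1] at this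
    have d02 : clawSort A x' i0 ≠ clawSort A x' i2 := fun e => by
      have := congrArg Fin.val ((clawSort A x').injective e); simp [i0, i2] at this
    have d12 : clawSort A x' i1 ≠ clawSort A x' i2 := fun e => by
      have := congrArg Fin.val ((clawSort A x').injective e); simp [i1, i2] at this
    have l0 : i0 ≤ j := Fin.mk_le_of_le_val (by omega)
    have l1 : i1 ≤ j := Fin.mk_le_of_le_val (by omega)
    have l2 : i2 ≤ j := Fin.mk_le_of_le_val (by omega)
    by_cases a0 : clawSort A x' i0 ≠ p ∧ clawSort A x' i0 ≠ q
    · exact ⟨i0, l0, a0⟩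
    by_cases a1 : clawSort A x' i1 ≠ p ∧ clawSort A x' i1 ≠ q
    · exact ⟨i1, l1, a1⟩
    rw [not_and_or, not_not, not_not] at a0 a1
    refine ⟨i2, l2, fun e => ?_, fun e => ?_⟩
    · rcases a0 with a0 | a0 <;> rcases a1 with a1 | a1
      · exact d01 (a0.trans a1.symm)
      · exact d02 (a0.trans e.symm)
      · exact d12 (a1.trans e.symm)
      · exact d01 (a0.trans a1.symm)
    · rcases a0 with a0 | a0 <;> rcases a1 with a1 | a1
      · exact d01 (a0.trans a1.symm)
      · exact d12 (a1.trans e.symm)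
      · exact d02 (a0.trans e.symm)
      · exact d01 (a0.trans a1.symm)
  obtain ⟨i, hij, hip, hiq⟩ := hex
  have hp := clawV_add_clawW_nonneg hA hip hiq h
  have hm : clawS A x' i ≤ clawS A x' j := clawS_monotone A x' hij
  unfold clawS at hm ⊢
  linarith

end vfacts

/-! ### The row decomposition and the theorem -/

/-- **Row decomposition**: `Cor_{P₁ ∧ clawPlus p q}(A,B) = Σ_{x∈P₁} v_A(x) v_B(x) + Cor_{P₁ ∧ claw k}(A,B)`. [this work] -/
theorem corP_andProd_clawPlus_eq {p q : Fin k} (hpq : p ≠ q) (P₁ : Finset (Finset γ₁)) (A B : Finset (Finset (γ₁ ⊕ Fin k))) :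
    corP (andProd P₁ (clawPlus p q)) A B = (∑ x ∈ P₁, clawV A p q x * clawV B p q x) + corP (andProd P₁ (claw k)) A B := by
  rw [corP_eq_sum, corP_eq_sum, andProd_eq_biUnion, sum_biUnion (pairwiseDisjoint_rows P₁ _), andProd_eq_biUnion,
    sum_biUnion (pairwiseDisjoint_rows P₁ _), ← sum_add_distrib]
  refine sum_congr rfl fun x _ => ?_
  rw [sum_map, sum_map, sum_clawPlus hpq]
  unfold clawV
  simp only [rowEmb_apply]

section mainthm
variable {P₁ : Finset (Finset γ₁)} (hP : IsUpperSet (P₁ : Set (Finset γ₁))) (hd : Disjoint P₁ (refl P₁))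
  (hcor : ∀ U V : Finset (Finset γ₁), IsUpperSet (U : Set (Finset γ₁)) → IsUpperSet (V : Set (Finset γ₁)) → 0 ≤ corP P₁ U V)
  {A B : Finset (Finset (γ₁ ⊕ Fin k))} (hA : IsUpperSet (A : Set (Finset (γ₁ ⊕ Fin k)))) (hB : IsUpperSet (B : Set (Finset (γ₁ ⊕ Fin k))))

include hP hd hcor hA hB in
/-- **THEOREM (AND with a claw-plus block, `k ≥ 4`).**  If `P₁` is an antipode-free up-set with `Cor_{P₁} ≥ 0` on all pairs of up-sets and
`p ≠ q`, then `Cor_{P₁ ∧ clawPlus p q}(A,B) ≥ 0` for all up-sets `A, B` of `2^{γ₁ ⊕ Fin k}`.  Proof: the claw main lemma leaves the slack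
`Σ cc'` (`c = s_{k-2}`), and `vv' + cc' = ½(v+c)(v'+c') + ½(c−v)(c'−v)`. [this work] -/
theorem corP_andProd_clawPlus_nonneg (hk : 4 ≤ k) {p q : Fin k} (hpq : p ≠ q) : 0 ≤ corP (andProd P₁ (clawPlus p q)) A B := by
  obtain ⟨jc, hjc⟩ : ∃ j : Fin k, (j : ℕ) = k - 2 := ⟨⟨k - 2, by omega⟩, rfl⟩
  rw [corP_andProd_clawPlus_eq hpq]
  have hmain := sum_clawS_sq_le_corP_andProd_claw hP hd hcor hA hB hk jc hjc
  -- `Σ (vv' + cc') ≥ 0`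
  have hid : ∀ x ∈ P₁, 2 * (clawV A p q x * clawV B p q x + clawS A x jc * clawS B x jc)
      = (clawV A p q x + clawS A x jc) * (clawV B p q x + clawS B x jc)
        + (clawS A x jc - clawV A p q x) * (clawS B x jc - clawV B p q x) := fun x _ => by ring
  have hnn : ∀ x ∈ P₁, 0 ≤ (clawS A x jc - clawV A p q x) * (clawS B x jc - clawV B p q x) := fun x _ =>
    mul_nonneg (sub_nonneg.2 (clawV_le_clawS hA hpq x jc hjc)) (sub_nonneg.2 (clawV_le_clawS hB hpq x jc hjc))
  have hjc2 : 2 ≤ (jc : ℕ) := by omega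
  have hkk := sum_mul_nonneg_of_two hP hd hcor (fun x => clawV A p q x + clawS A x jc) (fun x => clawV B p q x + clawS B x jc)
    (fun x _ => by have := clawV_bounds A p q x; have := clawS_bounds A x jc; constructor <;> linarith)
    (fun x _ => by have := clawV_bounds B p q x; have := clawS_bounds B x jc; constructor <;> linarith)
    (fun x _ x' _ h => add_le_add (clawV_mono hA h) (clawS_mono hA h jc))
    (fun x _ x' _ h => add_le_add (clawV_mono hB h) (clawS_mono hB h jc))
    (fun x _ x' _ h => by
      have h1 := clawV_add_clawS_nonneg hA (p := p) (q := q) h jc hjc2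
      have h2 := clawV_add_clawS_nonneg hA (p := p) (q := q) (by rw [union_comm]; exact h) jc hjc2
      linarith)
    (fun x _ x' _ h => by
      have h1 := clawV_add_clawS_nonneg hB (p := p) (q := q) h jc hjc2
      have h2 := clawV_add_clawS_nonneg hB (p := p) (q := q) (by rw [union_comm]; exact h) jc hjc2
      linarith)
  have h2 : 0 ≤ 2 * ∑ x ∈ P₁, (clawV A p q x * clawV B p q x + clawS A x jc * clawS B x jc) := by
    rw [mul_sum, sum_congr rfl hid, sum_add_distrib]
    exact add_nonneg hkk (sum_nonneg hnn)
  rw [sum_add_distrib] at h2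
  linarith

end mainthm

/-! ### Two extra columns from disjoint pairs (for the doubly-doubled claw) -/

section vtwofacts
variable {A : Finset (Finset (γ₁ ⊕ Fin k))} (hA : IsUpperSet (A : Set (Finset (γ₁ ⊕ Fin k)))) {p₁ q₁ p₂ q₂ : Fin k}
include hA

/-- Cross pair condition of the two extra columns (their elements cover `⊤`). [this work] -/
theorem clawV_add_clawV_nonneg (hpp : p₁ ≠ p₂) (hpq : p₁ ≠ q₂) (hqp : q₁ ≠ p₂) (hqq : q₁ ≠ q₂) {x x' : Finset γ₁} (hx : x ∪ x' = univ) :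
    0 ≤ clawV A p₁ q₁ x + clawV A p₂ q₂ x' := by
  rw [clawV_eq, clawV_eq]
  have hc : xᶜ ⊆ x' := by
    intro a ha; rw [mem_compl] at ha
    have := mem_univ a; rw [← hx, mem_union] at this; tauto
  have hc' : x'ᶜ ⊆ x := by
    intro a ha; rw [mem_compl] at ha
    have := mem_univ a; rw [← hx, mem_union] at this; tauto
  have h1s : ((univ.erase p₁).erase q₁)ᶜ ⊆ (univ.erase p₂).erase q₂ := by
    intro a ha
    rw [mem_compl] at ha
    have ha' : a = p₁ ∨ a = q₁ := by
      by_contra hne; rw [not_or] at hne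
      exact ha (mem_erase.2 ⟨hne.2, mem_erase.2 ⟨hne.1, mem_univ a⟩⟩)
    rcases ha' with rfl | rfl
    · exact mem_erase.2 ⟨hpq, mem_erase.2 ⟨hpp, mem_univ _⟩⟩
    · exact mem_erase.2 ⟨hqq, mem_erase.2 ⟨hqp, mem_univ _⟩⟩
  have h2s : ((univ.erase p₂).erase q₂)ᶜ ⊆ (univ.erase p₁).erase q₁ := by
    intro a ha
    rw [mem_compl] at ha
    have ha' : a = p₂ ∨ a = q₂ := by
      by_contra hne; rw [not_or] at hne
      exact ha (mem_erase.2 ⟨hne.2, mem_erase.2 ⟨hne.1, mem_univ a⟩⟩)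
    rcases ha' with rfl | rfl
    · exact mem_erase.2 ⟨fun e => hqp e.symm, mem_erase.2 ⟨fun e => hpp e.symm, mem_univ _⟩⟩
    · exact mem_erase.2 ⟨fun e => hqq e.symm, mem_erase.2 ⟨fun e => hpq e.symm, mem_univ _⟩⟩
  have i1 := ind_mono_pt hA (disjSum_mono hc h1s)
  have i2 := ind_mono_pt hA (disjSum_mono hc' h2s)
  linarith

end vtwofacts

/-- Two-term rearrangement: `v₁v₁' + v₂v₂' ≥ min·max' + max·min'`. [this work] -/
theorem rearr_two (a b a' b' : ℤ) : min a b * max a' b' + max a b * min a' b' ≤ a * a' + b * b' := by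
  simp only [min_def, max_def]; split_ifs <;> nlinarith

/-! ### Corollaries -/

variable {β : Type} [DecidableEq β] [Fintype β]

/-- The same theorem with the hypothesis in Kleitman-shell form. [this work] -/
theorem corP_andProd_clawPlus_nonneg_of_klShell (hk : 4 ≤ k) {p q : Fin k} (hpq : p ≠ q) {P₁ : Finset (Finset γ₁)}
    (hP : IsUpperSet (P₁ : Set (Finset γ₁))) (hd : Disjoint P₁ (refl P₁)) (hs : KlShell (P₁ ∪ refl P₁))
    {A B : Finset (Finset (γ₁ ⊕ Fin k))} (hA : IsUpperSet (A : Set (Finset (γ₁ ⊕ Fin k)))) (hB : IsUpperSet (B : Set (Finset (γ₁ ⊕ Fin k)))) :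
    0 ≤ corP (andProd P₁ (clawPlus p q)) A B :=
  corP_andProd_clawPlus_nonneg hP hd (fun U V hU hV => by rw [corP_eq_card_sub_card_of_disjoint hd]; exact hs U V hU hV) hA hB hk hpq

/-- **The AND-product with a claw-plus block is again an intersecting Kleitman shell.** [this work] -/
theorem klShell_andProd_clawPlus (hk : 4 ≤ k) {p q : Fin k} (hpq : p ≠ q) {P₁ : Finset (Finset γ₁)} (hP : IsUpperSet (P₁ : Set (Finset γ₁)))
    (hd : Disjoint P₁ (refl P₁))
    (hcor : ∀ U V : Finset (Finset γ₁), IsUpperSet (U : Set (Finset γ₁)) → IsUpperSet (V : Set (Finset γ₁)) → 0 ≤ corP P₁ U V) :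
    KlShell (andProd P₁ (clawPlus p q) ∪ refl (andProd P₁ (clawPlus p q))) :=
  klShell_of_corP_nonneg (disjoint_andProd_refl hd (clawPlus p q)) fun _ _ hA hB => corP_andProd_clawPlus_nonneg hP hd hcor hA hB hk hpq

/-- **`TriWIneq` for `P₁ ∧ clawPlus p q`** (`k ≥ 4`, `p ≠ q`) on every index cube, for every intersecting Kleitman shell `P₁`. [this work] -/
theorem triW_nonneg_andProd_clawPlus (hk : 4 ≤ k) {p q : Fin k} (hpq : p ≠ q) {P₁ : Finset (Finset γ₁)} (hP : IsUpperSet (P₁ : Set (Finset γ₁)))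
    (hd : Disjoint P₁ (refl P₁))
    (hcor : ∀ U V : Finset (Finset γ₁), IsUpperSet (U : Set (Finset γ₁)) → IsUpperSet (V : Set (Finset γ₁)) → 0 ≤ corP P₁ U V)
    (F G : Finset β → Finset (Finset (γ₁ ⊕ Fin k)))
    (hF : ∀ x, IsUpperSet (F x : Set (Finset (γ₁ ⊕ Fin k)))) (hG : ∀ x, IsUpperSet (G x : Set (Finset (γ₁ ⊕ Fin k))))
    (hFm : Monotone F) (hGm : Monotone G) :
    0 ≤ triW (andProd P₁ (clawPlus p q)) F G :=
  triW_nonneg_of_corP_nonneg (isUpperSet_andProd hP (isUpperSet_clawPlus hpq))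
    (fun _ _ hA hB => corP_andProd_clawPlus_nonneg hP hd hcor hA hB hk hpq) F G hF hG hFm hGm

/-- **`AndShellLower` for `Q = clawPlus p q`** (`k ≥ 4`, `p ≠ q`): the lower sandwich bound for `P₁ ∧ clawPlus p q`. [this work] -/
theorem lForm_le_scoreVal_andProd_clawPlus (hk : 4 ≤ k) {p q : Fin k} (hpq : p ≠ q) {P₁ : Finset (Finset γ₁)}
    (hP : IsUpperSet (P₁ : Set (Finset γ₁))) (hd : Disjoint P₁ (refl P₁)) (hs : KlShell (P₁ ∪ refl P₁))
    {A B : Finset (Finset (γ₁ ⊕ Fin k))} (hA : IsUpperSet (A : Set (Finset (γ₁ ⊕ Fin k)))) (hB : IsUpperSet (B : Set (Finset (γ₁ ⊕ Fin k)))) :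
    lForm (andProd P₁ (clawPlus p q)) A B ≤ scoreVal (secFAScore P₁ (clawPlus p q)) A B :=
  lForm_le_scoreVal_secFAScore_of_corP_nonneg (disjoint_clawPlus_refl hk hpq)
    (corP_andProd_clawPlus_nonneg_of_klShell hk hpq hP hd hs hA hB)

/-- Example: `maj3 ∧ clawPlus p q`, e.g. `maj3 ∧ e888` (`n = 7`). [this work] -/
theorem corP_maj3_andProd_clawPlus_nonneg (hk : 4 ≤ k) {p q : Fin k} (hpq : p ≠ q) {A B : Finset (Finset (Fin 3 ⊕ Fin k))}
    (hA : IsUpperSet (A : Set (Finset (Fin 3 ⊕ Fin k)))) (hB : IsUpperSet (B : Set (Finset (Fin 3 ⊕ Fin k)))) :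
    0 ≤ corP (andProd maj3 (clawPlus p q)) A B :=
  corP_andProd_clawPlus_nonneg isUpperSet_maj3 disjoint_maj3_refl (fun _ _ hU hV => corP_nonneg_of_selfDual maj3_selfDual hU hV) hA hB hk hpq

/-- The block `e888 = {01, 012, 013, 023, 123, 0123}` of the hard list is `clawPlus 2 3` on `Fin 4`. [this work] -/
theorem clawPlus_two_three : clawPlus (2 : Fin 4) 3 = {{0, 1}, {0, 1, 2}, {0, 1, 3}, {0, 2, 3}, {1, 2, 3}, {0, 1, 2, 3}} := by decide

end FiveUpSet

end Summit.CriticalPhenomena.PercolationContinuityZ3.Theorems
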